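import Summits.FinalStateConjecture.FinalStateConjecture.Theorems.EIHFluxBalanceInertialRecessionStubSlaving12JetCalculus

/-!
# Route EIHFluxBalance — `InertialRecession` (E′), line `SketchCleanExcision`:
# comparing the Ricci forms of two fields of metric components through their jets at a point
# (slaving stub `stub_slaving`)

Helper file for the crux `stmt-FinalStateConjecture-17403`
(`Summit.FinalStateConjecture.FinalStateConjecture.Theses.EIHFluxBalance.InertialRecession`, E′),
stub `stub_slaving`; the jet-space step of the `C²`/`C³` relative Ricci-smallness capstone
`…StubSlaving12RelRicci`, isolated from the ansatz. Two fields of metric components `G` (vacuum: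
`Ric G (0) = 0`, `D[Ric G](0) = 0`) and `G'` on an open `W ∋ 0` of the lab chart `E4`, whose
`2`-jets at `0` differ by `≤ δ` (and third derivatives by `≤ δ`), the jet of `G'` lying in a set
`K` near which the Ricci jet function `ricciJet` (`CoordRicciJet.lean`) is `L₀`-Lipschitz and its
derivative `L₁`-Lipschitz and bounded by `B₁` (radius `r ≥ δ`):

* `norm_comp_le_of_comp_eq_zero` — operator-norm bookkeeping for the chain rule;
* `norm_jet_sub_le` — the sup norm of a difference of jets `(0, A, B, C)`;
* `norm_ricAt_le_of_jets` — **`‖Ric G'(0)‖ ≤ L₀ δ`** (`ricAt_eq_ricciJet` for both fields);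
* `norm_fderiv_ricAt_le_of_jets` — **`‖D[Ric G'](0)‖ ≤ (L₁ + B₁) δ`** when moreover the jet map
  of `G'` has norm `≤ 1` (`‖DG'(0)‖, ‖D²G'(0)‖, ‖D³G'(0)‖ ≤ 1`): chain rule
  `D[Ric G](0) = D ricciJet(j₂G) ∘ Dj₂G` (`fderiv_ricAt_eq_comp_jetMap`) and
  `A₂ ∘ L' = (A₂ − A₁) ∘ L' + A₁ ∘ (L' − L) + A₁ ∘ L`.

Elementary; no definitions, no named facts.
-/

set_option linter.dupNamespace false
set_option maxSynthPendingDepth 6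
set_option synthInstance.maxHeartbeats 200000

noncomputable section

open scoped Topology ContDiff
open Filter Set Function Literature.Geometry.Lorentzian Literature.Geometry.Lorentzian.MetricCoord

namespace Summit.FinalStateConjecture.FinalStateConjecture.Theorems.SublinearIsFree.Slaving

/-- The space of `2`-jets of metric components on `E4` (local notation). -/
local notation "Jet" => E4 × (E4 →L[ℝ] E4 →L[ℝ] ℝ) × (E4 →L[ℝ] E4 →L[ℝ] E4 →L[ℝ] ℝ) ×
  (E4 →L[ℝ] E4 →L[ℝ] E4 →L[ℝ] E4 →L[ℝ] ℝ)

/-- **Operator-norm bookkeeping for the chain rule**: if `A₁ ∘ L = 0`, `‖A₂ − A₁‖ ≤ a`,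
`‖L'‖ ≤ 1`, `‖A₁‖ ≤ b` and `‖L' − L‖ ≤ d`, then `‖A₂ ∘ L'‖ ≤ a + b d`
(`A₂ ∘ L' = (A₂ − A₁) ∘ L' + A₁ ∘ (L' − L)`). [folklore] -/
theorem norm_comp_le_of_comp_eq_zero {E P Q : Type*} [NormedAddCommGroup E] [NormedSpace ℝ E]
    [NormedAddCommGroup P] [NormedSpace ℝ P] [NormedAddCommGroup Q] [NormedSpace ℝ Q]
    {A₁ A₂ : P →L[ℝ] Q} {L L' : E →L[ℝ] P} {a b d : ℝ} (h0 : A₁.comp L = 0)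
    (ha : ‖A₂ - A₁‖ ≤ a) (hL' : ‖L'‖ ≤ 1) (hb : ‖A₁‖ ≤ b) (hd : ‖L' - L‖ ≤ d) (ha0 : 0 ≤ a) :
    ‖A₂.comp L'‖ ≤ a + b * d := by
  have hb0 : 0 ≤ b := (norm_nonneg _).trans hb
  have hid : A₂.comp L' = (A₂ - A₁).comp L' + A₁.comp (L' - L) := by
    rw [ContinuousLinearMap.sub_comp, ContinuousLinearMap.comp_sub, h0, sub_zero, sub_add_cancel]
  rw [hid]
  calc ‖(A₂ - A₁).comp L' + A₁.comp (L' - L)‖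
      ≤ ‖(A₂ - A₁).comp L'‖ + ‖A₁.comp (L' - L)‖ := norm_add_le _ _
    _ ≤ ‖A₂ - A₁‖ * ‖L'‖ + ‖A₁‖ * ‖L' - L‖ :=
        add_le_add (ContinuousLinearMap.opNorm_comp_le _ _) (ContinuousLinearMap.opNorm_comp_le _ _)
    _ ≤ a * 1 + b * d :=
        add_le_add (mul_le_mul ha hL' (norm_nonneg _) ha0) (mul_le_mul hb hd (norm_nonneg _) hb0)
    _ = a + b * d := by ring

/-- The sup norm of a difference of jets with the same base point `0`. [folklore] -/
theorem norm_jet_sub_le {A A' : E4 →L[ℝ] E4 →L[ℝ] ℝ} {B B' : E4 →L[ℝ] E4 →L[ℝ] E4 →L[ℝ] ℝ}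
    {C C' : E4 →L[ℝ] E4 →L[ℝ] E4 →L[ℝ] E4 →L[ℝ] ℝ} {δ : ℝ} (hδ : 0 ≤ δ)
    (hA : ‖A - A'‖ ≤ δ) (hB : ‖B - B'‖ ≤ δ) (hC : ‖C - C'‖ ≤ δ) :
    ‖(((0 : E4), A, B, C) : Jet) - ((0 : E4), A', B', C')‖ ≤ δ := by
  simp only [Prod.mk_sub_mk, sub_zero, Prod.norm_def, norm_zero]
  exact max_le hδ (max_le hA (max_le hB hC))

/-- **`C²` comparison through the jets.** If `Ric G (0) = 0`, the `2`-jets of `G` and `G'` at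
`0` differ by `≤ δ ≤ r`, and `ricciJet` is `L₀`-Lipschitz on the `r`-balls around the points of a
set `K` containing the jet of `G'`, then `‖Ric G'(0)‖ ≤ L₀ δ`. [folklore] -/
theorem norm_ricAt_le_of_jets {G G' : E4 → E4 →L[ℝ] E4 →L[ℝ] ℝ} {W : Set E4}
    (hG : IsMetricOn G W) (hG' : IsMetricOn G' W) (h0 : (0 : E4) ∈ W)
    (hR0 : ricAt G 0 = 0) {K : Set Jet} {r L₀ δ : ℝ} (hL₀ : 0 ≤ L₀)
    (hLip₀ : ∀ j' ∈ K, ∀ j : Jet, ‖j - j'‖ ≤ r →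
      ‖ricciJet (E := E4) j - ricciJet (E := E4) j'‖ ≤ L₀ * ‖j - j'‖)
    (hK : (((0 : E4), G' 0, fderiv ℝ G' 0, fderiv ℝ (fderiv ℝ G') 0) : Jet) ∈ K)
    (hδ : 0 ≤ δ) (hδr : δ ≤ r) (hd0 : ‖G 0 - G' 0‖ ≤ δ)
    (hd1 : ‖fderiv ℝ G 0 - fderiv ℝ G' 0‖ ≤ δ)
    (hd2 : ‖fderiv ℝ (fderiv ℝ G) 0 - fderiv ℝ (fderiv ℝ G') 0‖ ≤ δ) :
    ‖ricAt G' 0‖ ≤ L₀ * δ := by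
  have hJJ' : ‖(((0 : E4), G 0, fderiv ℝ G 0, fderiv ℝ (fderiv ℝ G) 0) : Jet) -
      ((0 : E4), G' 0, fderiv ℝ G' 0, fderiv ℝ (fderiv ℝ G') 0)‖ ≤ δ :=
    norm_jet_sub_le hδ hd0 hd1 hd2
  have hRJ : ricciJet (E := E4) ((0 : E4), G 0, fderiv ℝ G 0, fderiv ℝ (fderiv ℝ G) 0) = 0 := by
    rw [← ricAt_eq_ricciJet hG h0]; exact hR0
  have hRJ' : ricciJet (E := E4) ((0 : E4), G' 0, fderiv ℝ G' 0, fderiv ℝ (fderiv ℝ G') 0) =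
      ricAt G' 0 := (ricAt_eq_ricciJet hG' h0).symm
  have h := hLip₀ _ hK _ (hJJ'.trans hδr)
  rw [hRJ, zero_sub, norm_neg, hRJ'] at h
  exact h.trans (mul_le_mul_of_nonneg_left hJJ' hL₀)

set_option maxHeartbeats 800000 in
/-- **`C³` comparison through the jets.** If moreover `D[Ric G](0) = 0`, the third derivatives
differ by `≤ δ`, the derivative of `ricciJet` is `L₁`-Lipschitz and bounded by `B₁` on the
`r`-balls around the points of `K`, and `‖DG'(0)‖, ‖D²G'(0)‖, ‖D³G'(0)‖ ≤ 1`, then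
`‖D[Ric G'](0)‖ ≤ (L₁ + B₁) δ`. [folklore] -/
theorem norm_fderiv_ricAt_le_of_jets {G G' : E4 → E4 →L[ℝ] E4 →L[ℝ] ℝ} {W : Set E4}
    (hG : IsMetricOn G W) (hG' : IsMetricOn G' W) (h0 : (0 : E4) ∈ W)
    (hDR0 : fderiv ℝ (ricAt G) 0 = 0) {K : Set Jet} {r L₁ B₁ δ : ℝ} (hL₁ : 0 ≤ L₁)
    (hLip₁ : ∀ j' ∈ K, ∀ j : Jet, ‖j - j'‖ ≤ r →
      ‖fderiv ℝ (ricciJet (E := E4)) j - fderiv ℝ (ricciJet (E := E4)) j'‖ ≤ L₁ * ‖j - j'‖ ∧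
        ‖fderiv ℝ (ricciJet (E := E4)) j‖ ≤ B₁)
    (hK : (((0 : E4), G' 0, fderiv ℝ G' 0, fderiv ℝ (fderiv ℝ G') 0) : Jet) ∈ K)
    (hδ : 0 ≤ δ) (hδr : δ ≤ r) (hd0 : ‖G 0 - G' 0‖ ≤ δ)
    (hd1 : ‖fderiv ℝ G 0 - fderiv ℝ G' 0‖ ≤ δ)
    (hd2 : ‖fderiv ℝ (fderiv ℝ G) 0 - fderiv ℝ (fderiv ℝ G') 0‖ ≤ δ)
    (hd3 : ‖fderiv ℝ (fderiv ℝ (fderiv ℝ G)) 0 - fderiv ℝ (fderiv ℝ (fderiv ℝ G')) 0‖ ≤ δ)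
    (hn1 : ‖fderiv ℝ G' 0‖ ≤ 1) (hn2 : ‖fderiv ℝ (fderiv ℝ G') 0‖ ≤ 1)
    (hn3 : ‖fderiv ℝ (fderiv ℝ (fderiv ℝ G')) 0‖ ≤ 1) :
    ‖fderiv ℝ (ricAt G') 0‖ ≤ (L₁ + B₁) * δ := by
  have hJJ' : ‖(((0 : E4), G 0, fderiv ℝ G 0, fderiv ℝ (fderiv ℝ G) 0) : Jet) -
      ((0 : E4), G' 0, fderiv ℝ G' 0, fderiv ℝ (fderiv ℝ G') 0)‖ ≤ δ :=
    norm_jet_sub_le hδ hd0 hd1 hd2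
  have hcomp := fderiv_ricAt_eq_comp_jetMap hG h0
  have hcomp' := fderiv_ricAt_eq_comp_jetMap hG' h0
  rw [hDR0] at hcomp
  have hLn : ‖(ContinuousLinearMap.id ℝ E4).prod ((fderiv ℝ G' 0).prod ((fderiv ℝ (fderiv ℝ G') 0).prod
      (fderiv ℝ (fderiv ℝ (fderiv ℝ G')) 0)))‖ ≤ 1 := norm_jetCLM_le _ _ _ hn1 hn2 hn3
  have hLd : ‖(ContinuousLinearMap.id ℝ E4).prod ((fderiv ℝ G' 0).prod ((fderiv ℝ (fderiv ℝ G') 0).prod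
      (fderiv ℝ (fderiv ℝ (fderiv ℝ G')) 0))) -
      (ContinuousLinearMap.id ℝ E4).prod ((fderiv ℝ G 0).prod ((fderiv ℝ (fderiv ℝ G) 0).prod
      (fderiv ℝ (fderiv ℝ (fderiv ℝ G)) 0)))‖ ≤ δ := by
    refine norm_jetCLM_sub_le _ _ _ _ _ _ hδ ?_ ?_ ?_
    · rw [norm_sub_rev]; exact hd1
    · rw [norm_sub_rev]; exact hd2
    · rw [norm_sub_rev]; exact hd3
  obtain ⟨hA12, hB⟩ := hLip₁ _ hK _ (hJJ'.trans hδr)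
  have hB₁ : 0 ≤ B₁ := (norm_nonneg _).trans hB
  have hA21 : ‖fderiv ℝ (ricciJet (E := E4)) ((0 : E4), G' 0, fderiv ℝ G' 0, fderiv ℝ (fderiv ℝ G') 0) -
      fderiv ℝ (ricciJet (E := E4)) ((0 : E4), G 0, fderiv ℝ G 0, fderiv ℝ (fderiv ℝ G) 0)‖ ≤ L₁ * δ := by
    rw [norm_sub_rev]; exact hA12.trans (mul_le_mul_of_nonneg_left hJJ' hL₁)
  rw [hcomp']
  exact (norm_comp_le_of_comp_eq_zero hcomp.symm hA21 hLn hB hLd (mul_nonneg hL₁ hδ)).trans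
    (le_of_eq (by ring))

/-- **Registered one-line carrier form** (`slaving_norm_ricAt_le_of_jets_slaving12`) of
`norm_ricAt_le_of_jets`. [folklore] -/
theorem slaving_norm_ricAt_le_of_jets_slaving12 : open Literature.Geometry.Lorentzian in ∀ {G G' : E4 → E4 →L[ℝ] E4 →L[ℝ] ℝ} {W : Set E4}, MetricCoord.IsMetricOn G W → MetricCoord.IsMetricOn G' W → (0 : E4) ∈ W → MetricCoord.ricAt G 0 = 0 → ∀ {K : Set (E4 × (E4 →L[ℝ] E4 →L[ℝ] ℝ) × (E4 →L[ℝ] E4 →L[ℝ] E4 →L[ℝ] ℝ) × (E4 →L[ℝ] E4 →L[ℝ] E4 →L[ℝ] E4 →L[ℝ] ℝ))} {r L₀ δ : ℝ}, 0 ≤ L₀ → (∀ j' ∈ K, ∀ j : E4 × (E4 →L[ℝ] E4 →L[ℝ] ℝ) × (E4 →L[ℝ] E4 →L[ℝ] E4 →L[ℝ] ℝ) × (E4 →L[ℝ] E4 →L[ℝ] E4 →L[ℝ] E4 →L[ℝ] ℝ), ‖j - j'‖ ≤ r → ‖MetricCoord.ricciJet (E := E4) j - MetricCoord.ricciJet (E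 := E4) j'‖ ≤ L₀ * ‖j - j'‖) → (((0 : E4), G' 0, fderiv ℝ G' 0, fderiv ℝ (fderiv ℝ G') 0) : E4 × (E4 →L[ℝ] E4 →L[ℝ] ℝ) × (E4 →L[ℝ] E4 →L[ℝ] E4 →L[ℝ] ℝ) × (E4 →L[ℝ] E4 →L[ℝ] E4 →L[ℝ] E4 →L[ℝ] ℝ)) ∈ K → 0 ≤ δ → δ ≤ r → ‖G 0 - G' 0‖ ≤ δ → ‖fderiv ℝ G 0 - fderiv ℝ G' 0‖ ≤ δ → ‖fderiv ℝ (fderiv ℝ G) 0 - fderiv ℝ (fderiv ℝ G') 0‖ ≤ δ → ‖MetricCoord.ricAt G' 0‖ ≤ L₀ * δ :=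
  fun hG hG' h0 hR0 _ _ _ _ hL₀ hLip₀ hK hδ hδr hd0 hd1 hd2 ↦
    norm_ricAt_le_of_jets hG hG' h0 hR0 hL₀ hLip₀ hK hδ hδr hd0 hd1 hd2

end Summit.FinalStateConjecture.FinalStateConjecture.Theorems.SublinearIsFree.Slaving

end
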